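import Summits.NavierStokesRegularity.NavierStokesRegularity.Theorems.IsobarTomographyIsobaricLinesLiouvilleHullReductionFive
import Summits.NavierStokesRegularity.NavierStokesRegularity.Theorems.IsobarTomographyIsobaricLinesLiouvilleStubShearTranslationLeaf
import HarnessLib

/-!
# Five-hull reduction with the SHEAR hull for the crux `IsobaricLinesLiouville` (stmt-NavierStokesRegularity-11741), line `Ideator2Sketch` (v8)

Lead file (continuation lead c2; supports the crux). The translation hull (B) of
`…HullReductionFive` (velocity invariant along one fixed direction `a`) is replaced by the strictly
larger SHEAR hull (B′): the velocity changes along `a` only by multiples of `a`,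
`v(t, x + δa) − v(t, x) ∈ ℝa`. Its leaf is the landed `stub_shearTranslationLeaf`
(incompressibility makes `δ ↦ ⟪v(t, x + δa), a⟫` affine, boundedness makes it constant). The shear
hull is the global form of the conjectured local normal form of the swirling axisymmetric isobaric
class (crux dir `AxiRigidity-c2.md`, REV 4–6: the exact z-linear family `u = h(r)`,
`w = z f(r) + g(r)`, `v_θ = V(r)` — horizontal part invariant along the axis, axial part affine).

`isobaricLinesLiouville_of_hull5s` / `hull5s_of_isobaricLinesLiouville`: the v8 form of the line's
one open stub `stub_hullRigidity` implies the crux and is implied by it.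
Sources: Koch–Nadirashvili–Seregin–Šverák 2009 (arXiv:0709.3599) Thms 5.1–5.2 (through the leaves).
-/

noncomputable section

-- the summit and its single problem share the name (D-0017 nested layout)
set_option linter.dupNamespace false

namespace Summit.NavierStokesRegularity.NavierStokesRegularity.Theorems.IsobaricLinesLiouville.FluxSurfacePersistence

open scoped InnerProductSpace RealInnerProductSpace Topology ContDiff Laplacian
open Literature.Analysis.FluidPDE Set Filter MeasureTheory Function WithLp
open Summit.NavierStokesRegularity.NavierStokesRegularity.Theses.IsobarTomography

/-- **Five-hull rigidity with the shear hull implies the crux** (v8 assembly of line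
`Ideator2Sketch`): as `isobaricLinesLiouville_of_hull5`, with disjunct (B) weakened to the shear
hull (B′) `v(t, x + δa) − v(t, x) ∈ ℝa`, closed by `stub_shearTranslationLeaf`. -/
theorem isobaricLinesLiouville_of_hull5s :
    (∀ (v : ℝ → (EuclideanSpace ℝ (Fin 3)) → (EuclideanSpace ℝ (Fin 3)))
      (q : ℝ → (EuclideanSpace ℝ (Fin 3)) → ℝ),
      IsBoundedAncientMildSolution 1 v → IsClassicalNSSolutionOn (Set.Iio 0) 1 0 v q →
      (∀ t < 0, ∀ x : EuclideanSpace ℝ (Fin 3), ⟪curl (v t) x, gradient (q t) x⟫_ℝ = 0) →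
      (∀ t < 0, ∀ x : EuclideanSpace ℝ (Fin 3),
        ⟪curl (v t) x,
            gradient (fun y => timeDerivWithin (Set.Iio 0) q t y + ⟪v t y, gradient (q t) y⟫_ℝ) x⟫_ℝ
          = - ⟪(Δ (curl (v t))) x, gradient (q t) x⟫_ℝ) →
      (∀ t < 0, ∀ x : EuclideanSpace ℝ (Fin 3),
        ⟪curl (v t) x, timeDerivWithin (Set.Iio 0) v t x⟫_ℝ
          + ⟪curl (v t) x, gradient (fun y => ‖v t y‖ ^ 2 / 2) x⟫_ℝ
          + ⟪curl (v t) x, curl (curl (v t)) x⟫_ℝ = 0) →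
      (∀ t < 0, ∀ (γ : ℝ → EuclideanSpace ℝ (Fin 3)) (T : ℝ), 0 < T →
        (∀ s, HasDerivAt γ (curl (v t) (γ s)) s) → Function.Periodic γ T →
          ∫ s in (0 : ℝ)..T, ⟪(Δ (curl (v t))) (γ s), gradient (q t) (γ s)⟫_ℝ = 0) →
      (∃ a : EuclideanSpace ℝ (Fin 3), ∀ t < 0, ∀ x : EuclideanSpace ℝ (Fin 3),
          ∃ μ : ℝ, curl (v t) x = μ • a) ∨
      (∃ a : EuclideanSpace ℝ (Fin 3), a ≠ 0 ∧ ∀ t < 0, ∀ (x : EuclideanSpace ℝ (Fin 3)) (δ : ℝ),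
          ∃ μ : ℝ, v t (x + δ • a) - v t x = μ • a) ∨
      (∃ e c : EuclideanSpace ℝ (Fin 3), e ≠ 0 ∧ ∀ t < 0, ∀ x : EuclideanSpace ℝ (Fin 3),
          fderiv ℝ (v t) x (cross e (x - c)) = cross e (v t x) ∧ ⟪v t x, cross e (x - c)⟫_ℝ = 0) ∨
      (∃ a b c : EuclideanSpace ℝ (Fin 3), ⟪a, b⟫_ℝ ≠ 0 ∧ ∀ t < 0, ∀ x : EuclideanSpace ℝ (Fin 3),
          cross (curl (v t) x) (cross a (x - c) + b) = 0 ∧ ⟪v t x, cross a (x - c) + b⟫_ℝ = 0) ∨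
      (∃ e₁ e₂ : EuclideanSpace ℝ (Fin 3), cross e₁ e₂ ≠ 0 ∧ ∀ t < 0, ∀ x : EuclideanSpace ℝ (Fin 3),
          ⟪curl (v t) x, gradient (fun y => ⟪v t y, e₁⟫_ℝ) x⟫_ℝ = 0 ∧
          ⟪curl (v t) x, gradient (fun y => ⟪v t y, e₂⟫_ℝ) x⟫_ℝ = 0)) →
    IsobaricLinesLiouville := by
  intro hull v q hanc hcl hiso
  have hP := persistence_identity v q hcl hiso
  have hT := twist_identity_isobaric v q hcl hiso
  have hN := stub_newcombClosedLine v q hcl hP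
  rcases hull v q hanc hcl hiso hP hT hN with
    ⟨a, h⟩ | ⟨a, ha, h⟩ | ⟨e, c, he, h⟩ | ⟨a, b, c, hab, h⟩ | ⟨e₁, e₂, hn, h⟩
  · exact sliceConst_of_curl_parallel v q hanc hcl a h
  · exact stub_shearTranslationLeaf v q hanc hcl a ha h
  · exact sliceConst_of_axisym v q hanc hcl e c he (fun t ht x => (h t ht x).1)
      (fun t ht x => (h t ht x).2)
  · exact stub_screwLeaf v q hanc hcl hiso a b c hab h
  · exact sliceConst_of_twoStretchFree v q hanc hcl e₁ e₂ hn h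

/-- **The crux implies five-hull rigidity with the shear hull** (so the v8 stub of line
`Ideator2Sketch` is still EQUIVALENT to the crux): constant slices have vanishing vorticity
(`curl_const_eq_zero`), hull (A) with `a = 0`. -/
theorem hull5s_of_isobaricLinesLiouville :
    IsobaricLinesLiouville → ∀ (v : ℝ → (EuclideanSpace ℝ (Fin 3)) → (EuclideanSpace ℝ (Fin 3)))
      (q : ℝ → (EuclideanSpace ℝ (Fin 3)) → ℝ),
      IsBoundedAncientMildSolution 1 v → IsClassicalNSSolutionOn (Set.Iio 0) 1 0 v q →
      (∀ t < 0, ∀ x : EuclideanSpace ℝ (Fin 3), ⟪curl (v t) x, gradient (q t) x⟫_ℝ = 0) →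
      (∀ t < 0, ∀ x : EuclideanSpace ℝ (Fin 3),
        ⟪curl (v t) x,
            gradient (fun y => timeDerivWithin (Set.Iio 0) q t y + ⟪v t y, gradient (q t) y⟫_ℝ) x⟫_ℝ
          = - ⟪(Δ (curl (v t))) x, gradient (q t) x⟫_ℝ) →
      (∀ t < 0, ∀ x : EuclideanSpace ℝ (Fin 3),
        ⟪curl (v t) x, timeDerivWithin (Set.Iio 0) v t x⟫_ℝ
          + ⟪curl (v t) x, gradient (fun y => ‖v t y‖ ^ 2 / 2) x⟫_ℝ
          + ⟪curl (v t) x, curl (curl (v t)) x⟫_ℝ = 0) →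
      (∀ t < 0, ∀ (γ : ℝ → EuclideanSpace ℝ (Fin 3)) (T : ℝ), 0 < T →
        (∀ s, HasDerivAt γ (curl (v t) (γ s)) s) → Function.Periodic γ T →
          ∫ s in (0 : ℝ)..T, ⟪(Δ (curl (v t))) (γ s), gradient (q t) (γ s)⟫_ℝ = 0) →
      (∃ a : EuclideanSpace ℝ (Fin 3), ∀ t < 0, ∀ x : EuclideanSpace ℝ (Fin 3),
          ∃ μ : ℝ, curl (v t) x = μ • a) ∨
      (∃ a : EuclideanSpace ℝ (Fin 3), a ≠ 0 ∧ ∀ t < 0, ∀ (x : EuclideanSpace ℝ (Fin 3)) (δ : ℝ),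
          ∃ μ : ℝ, v t (x + δ • a) - v t x = μ • a) ∨
      (∃ e c : EuclideanSpace ℝ (Fin 3), e ≠ 0 ∧ ∀ t < 0, ∀ x : EuclideanSpace ℝ (Fin 3),
          fderiv ℝ (v t) x (cross e (x - c)) = cross e (v t x) ∧ ⟪v t x, cross e (x - c)⟫_ℝ = 0) ∨
      (∃ a b c : EuclideanSpace ℝ (Fin 3), ⟪a, b⟫_ℝ ≠ 0 ∧ ∀ t < 0, ∀ x : EuclideanSpace ℝ (Fin 3),
          cross (curl (v t) x) (cross a (x - c) + b) = 0 ∧ ⟪v t x, cross a (x - c) + b⟫_ℝ = 0) ∨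
      (∃ e₁ e₂ : EuclideanSpace ℝ (Fin 3), cross e₁ e₂ ≠ 0 ∧ ∀ t < 0, ∀ x : EuclideanSpace ℝ (Fin 3),
          ⟪curl (v t) x, gradient (fun y => ⟪v t y, e₁⟫_ℝ) x⟫_ℝ = 0 ∧
          ⟪curl (v t) x, gradient (fun y => ⟪v t y, e₂⟫_ℝ) x⟫_ℝ = 0) := by
  intro hL v q hanc hcl hiso _ _ _
  left
  refine ⟨0, fun t ht x => ⟨0, ?_⟩⟩
  obtain ⟨b, hb⟩ := hL v q hanc hcl hiso t ht
  rw [hb, curl_const_eq_zero, zero_smul]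

/-- Registered tools stub of line `Ideator2Sketch` v8 (`ledger workitem stub-add … --name stub_hull5sTools`):
the shear-hull assembly and its converse, by name. -/
theorem stub_hull5sTools :
    ((∀ (v : ℝ → (EuclideanSpace ℝ (Fin 3)) → (EuclideanSpace ℝ (Fin 3)))
      (q : ℝ → (EuclideanSpace ℝ (Fin 3)) → ℝ),
      IsBoundedAncientMildSolution 1 v → IsClassicalNSSolutionOn (Set.Iio 0) 1 0 v q →
      (∀ t < 0, ∀ x : EuclideanSpace ℝ (Fin 3), ⟪curl (v t) x, gradient (q t) x⟫_ℝ = 0) →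
      (∀ t < 0, ∀ x : EuclideanSpace ℝ (Fin 3),
        ⟪curl (v t) x,
            gradient (fun y => timeDerivWithin (Set.Iio 0) q t y + ⟪v t y, gradient (q t) y⟫_ℝ) x⟫_ℝ
          = - ⟪(Δ (curl (v t))) x, gradient (q t) x⟫_ℝ) →
      (∀ t < 0, ∀ x : EuclideanSpace ℝ (Fin 3),
        ⟪curl (v t) x, timeDerivWithin (Set.Iio 0) v t x⟫_ℝ
          + ⟪curl (v t) x, gradient (fun y => ‖v t y‖ ^ 2 / 2) x⟫_ℝ
          + ⟪curl (v t) x, curl (curl (v t)) x⟫_ℝ = 0) →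
      (∀ t < 0, ∀ (γ : ℝ → EuclideanSpace ℝ (Fin 3)) (T : ℝ), 0 < T →
        (∀ s, HasDerivAt γ (curl (v t) (γ s)) s) → Function.Periodic γ T →
          ∫ s in (0 : ℝ)..T, ⟪(Δ (curl (v t))) (γ s), gradient (q t) (γ s)⟫_ℝ = 0) →
      (∃ a : EuclideanSpace ℝ (Fin 3), ∀ t < 0, ∀ x : EuclideanSpace ℝ (Fin 3),
          ∃ μ : ℝ, curl (v t) x = μ • a) ∨
      (∃ a : EuclideanSpace ℝ (Fin 3), a ≠ 0 ∧ ∀ t < 0, ∀ (x : EuclideanSpace ℝ (Fin 3)) (δ : ℝ),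
          ∃ μ : ℝ, v t (x + δ • a) - v t x = μ • a) ∨
      (∃ e c : EuclideanSpace ℝ (Fin 3), e ≠ 0 ∧ ∀ t < 0, ∀ x : EuclideanSpace ℝ (Fin 3),
          fderiv ℝ (v t) x (cross e (x - c)) = cross e (v t x) ∧ ⟪v t x, cross e (x - c)⟫_ℝ = 0) ∨
      (∃ a b c : EuclideanSpace ℝ (Fin 3), ⟪a, b⟫_ℝ ≠ 0 ∧ ∀ t < 0, ∀ x : EuclideanSpace ℝ (Fin 3),
          cross (curl (v t) x) (cross a (x - c) + b) = 0 ∧ ⟪v t x, cross a (x - c) + b⟫_ℝ = 0) ∨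
      (∃ e₁ e₂ : EuclideanSpace ℝ (Fin 3), cross e₁ e₂ ≠ 0 ∧ ∀ t < 0, ∀ x : EuclideanSpace ℝ (Fin 3),
          ⟪curl (v t) x, gradient (fun y => ⟪v t y, e₁⟫_ℝ) x⟫_ℝ = 0 ∧
          ⟪curl (v t) x, gradient (fun y => ⟪v t y, e₂⟫_ℝ) x⟫_ℝ = 0)) →
    IsobaricLinesLiouville) ∧
    (IsobaricLinesLiouville → ∀ (v : ℝ → (EuclideanSpace ℝ (Fin 3)) → (EuclideanSpace ℝ (Fin 3)))
      (q : ℝ → (EuclideanSpace ℝ (Fin 3)) → ℝ),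
      IsBoundedAncientMildSolution 1 v → IsClassicalNSSolutionOn (Set.Iio 0) 1 0 v q →
      (∀ t < 0, ∀ x : EuclideanSpace ℝ (Fin 3), ⟪curl (v t) x, gradient (q t) x⟫_ℝ = 0) →
      (∀ t < 0, ∀ x : EuclideanSpace ℝ (Fin 3),
        ⟪curl (v t) x,
            gradient (fun y => timeDerivWithin (Set.Iio 0) q t y + ⟪v t y, gradient (q t) y⟫_ℝ) x⟫_ℝ
          = - ⟪(Δ (curl (v t))) x, gradient (q t) x⟫_ℝ) →
      (∀ t < 0, ∀ x : EuclideanSpace ℝ (Fin 3),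
        ⟪curl (v t) x, timeDerivWithin (Set.Iio 0) v t x⟫_ℝ
          + ⟪curl (v t) x, gradient (fun y => ‖v t y‖ ^ 2 / 2) x⟫_ℝ
          + ⟪curl (v t) x, curl (curl (v t)) x⟫_ℝ = 0) →
      (∀ t < 0, ∀ (γ : ℝ → EuclideanSpace ℝ (Fin 3)) (T : ℝ), 0 < T →
        (∀ s, HasDerivAt γ (curl (v t) (γ s)) s) → Function.Periodic γ T →
          ∫ s in (0 : ℝ)..T, ⟪(Δ (curl (v t))) (γ s), gradient (q t) (γ s)⟫_ℝ = 0) →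
      (∃ a : EuclideanSpace ℝ (Fin 3), ∀ t < 0, ∀ x : EuclideanSpace ℝ (Fin 3),
          ∃ μ : ℝ, curl (v t) x = μ • a) ∨
      (∃ a : EuclideanSpace ℝ (Fin 3), a ≠ 0 ∧ ∀ t < 0, ∀ (x : EuclideanSpace ℝ (Fin 3)) (δ : ℝ),
          ∃ μ : ℝ, v t (x + δ • a) - v t x = μ • a) ∨
      (∃ e c : EuclideanSpace ℝ (Fin 3), e ≠ 0 ∧ ∀ t < 0, ∀ x : EuclideanSpace ℝ (Fin 3),
          fderiv ℝ (v t) x (cross e (x - c)) = cross e (v t x) ∧ ⟪v t x, cross e (x - c)⟫_ℝ = 0) ∨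
      (∃ a b c : EuclideanSpace ℝ (Fin 3), ⟪a, b⟫_ℝ ≠ 0 ∧ ∀ t < 0, ∀ x : EuclideanSpace ℝ (Fin 3),
          cross (curl (v t) x) (cross a (x - c) + b) = 0 ∧ ⟪v t x, cross a (x - c) + b⟫_ℝ = 0) ∨
      (∃ e₁ e₂ : EuclideanSpace ℝ (Fin 3), cross e₁ e₂ ≠ 0 ∧ ∀ t < 0, ∀ x : EuclideanSpace ℝ (Fin 3),
          ⟪curl (v t) x, gradient (fun y => ⟪v t y, e₁⟫_ℝ) x⟫_ℝ = 0 ∧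
          ⟪curl (v t) x, gradient (fun y => ⟪v t y, e₂⟫_ℝ) x⟫_ℝ = 0)) :=
  ⟨isobaricLinesLiouville_of_hull5s, hull5s_of_isobaricLinesLiouville⟩

end Summit.NavierStokesRegularity.NavierStokesRegularity.Theorems.IsobaricLinesLiouville.FluxSurfacePersistence

end
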